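import Summits.QuantumAdvantage.QuantumAdvantage.Theses.OddPrimeWalk
import Summits.QuantumAdvantage.AdviceFreeQNC0.WalkHardFFewReaders
import HarnessLib

/-!
# Crux `DenseResidualSqrtOdd` (stmt-QuantumAdvantage-23029), registered stub `stub_fewReadersOdd` (rung R8) — PROVED

Planner qa-qnc0-p2 g15's BC3 skeleton of the `√n`-dense residual (ROUND-15 (p2) §3.6) has two stubs; this file lands the
provable one, `stub_fewReadersOdd = ∀ p ≥ 5, WalkHardFFewReaders p`: a polylog-`𝔽_p`-degree strategy for α's u-walk game in
which SOME adjacent bit pair is read by at most `(log₂ n)^C` far cuts (plus the cuts within distance `w ≤ (log₂ n)^C`) wins on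
at most `θ·2ⁿ` inputs, `θ = 1 − η₀(p)/4`.  One line over the tree theorem
`Summit.QuantumAdvantage.AdviceFreeQNC0.walkHardFFewReaders (p) (hp3 : p ≠ 3)` (`AdviceFreeQNC0/WalkHardFFewReaders.lean`:
reader-free block, three-speed parity identity, level-set elimination on the block, fibre double count).
WHAT THIS IS NOT: the other stub `stub_manyReadersSqrtOdd` (every pair has more than polylog far readers) is the open research
residual; the crux itself is NOT closed by this file; separation NOT moved.
-/

set_option linter.dupNamespace false

namespace Summit.QuantumAdvantage.QuantumAdvantage.Theorems.DenseResidualSqrtOdd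

/-- **Stub `stub_fewReadersOdd` (rung R8) — PROVED**: `∀ p ≥ 5, WalkHardFFewReaders p` (registered signature, verbatim). -/
theorem stub_fewReadersOdd : ∀ (p : ℕ) [Fact p.Prime], 5 ≤ p → ∃ θ : ℝ, θ < 1 ∧ ∀ C : ℕ, ∃ n₀ : ℕ, ∀ n ≥ n₀, ∀ c w a : ℕ, w ≤ (Nat.log 2 n) ^ C → a + 2 ≤ n → ∀ y : Fin (n + 1) → (Fin n → Bool) → Bool, (∀ g, AdviceFreeQNC0.HasDegF p (y g) ((Nat.log 2 n) ^ C)) → ∀ S : Finset (Fin (n + 1)), S.card ≤ (Nat.log 2 n) ^ C → (∀ g : Fin (n + 1), g ∉ S → (g.val + w < a ∨ a + 2 + w < g.val) → ∀ u v : Fin n → Bool, (∀ i : Fin n, i.val ≠ a → i.val ≠ a + 1 → u i = v i) → y g u = y g v) → ((Finset.univ.filter fun u : Fin n → Bool => AdviceFreeQNC0.ringWinU c y u = true).card : ℝ) ≤ θ * (2 : ℝ) ^ n :=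
  fun p _ hp => Summit.QuantumAdvantage.AdviceFreeQNC0.walkHardFFewReaders p (by omega)

/-- The route-level form: `∀ p ≥ 5, WalkHardFFewReaders p` (the planner's child `FewReadersOdd`, stmt-QuantumAdvantage-23108,
has this body verbatim). -/
theorem fewReadersOdd : ∀ (p : ℕ) [Fact p.Prime], 5 ≤ p → Summit.QuantumAdvantage.AdviceFreeQNC0.WalkHardFFewReaders p :=
  fun p _ hp => Summit.QuantumAdvantage.AdviceFreeQNC0.walkHardFFewReaders p (by omega)

end Summit.QuantumAdvantage.QuantumAdvantage.Theorems.DenseResidualSqrtOdd
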